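import Summits.ResolutionOfSingularities.ResolutionOfSingularities.Theorems.FrobeniusClosingSteerNonRationalWindowBiConeForms
import Mathlib.Algebra.MvPolynomial.Funext
import Mathlib.LinearAlgebra.StdBasis
import HarnessLib

/-!
# Crux `Steer` (stmt-ResolutionOfSingularities-16345), chain W4.1 — NRA bi-cone lemma, FILE 3: THE FRAME READ-OFF
# (translation invariance along the frame directions ⇒ the re-coordinatised polynomial forgets the free variables and is a form)

OURS (campaign `res-hironaka`, rung L ★L-G4, slot W4.1; bi-cone lemma `NonRationalWindow.BiCone`, route `NRA/BiCone-PROOF-ROUTE.md` 7e57beb60ac2f3f0 §1/§4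
made index-concrete; seat res-D-pv-053 g9 on res-L0-w41-plan-1 RULING 286 (d)). Candidates, not facts; nothing here is a statement of H. Hironakaʼs
manuscript [Hironaka2017] (status: under review). AI-written; AI review is weaker than expert review. Definition-free, Mathlib-only.

## The frame (all data explicit, no definitions)
`k ⊆ K` fields, `K` infinite; `J ⊆ Fin n` (the FREE indices), coefficients `a : Fin n → Fin n → k`, constants `e : Fin n → k`; the BOUND affine forms
`λ_i := X_i − C e_i − Σ_{j∈J} C a_ij X_j` (`i ∉ J`); the re-coordinatisation `Ψ : X_i ↦ X_i + C e_i + Σ_{j∈J} C a_ij X_j` (`i ∉ J`), `X_j ↦ X_j` (`j ∈ J`),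
its inverse `Φ : X_i ↦ λ_i`, the projection `κ : X_j ↦ 0` (`j ∈ J`); the frame directions `v_j` (`j ∈ J`): `(v_j)_i = δ_ij` on `J`, `a_ij` off `J`.
A set `P` of VERTICES of `g` of degree `d` (translates `g_K(X + p)` are forms of degree `d`) at which every `λ_i` vanishes, whose differences span
the `v_j`.

## What is proved
* `eval_bind₁_frame`, `eval_bind₁_kill`, `frame_shift` — evaluation of the three substitutions and the vector identity `Ψ*(x) = Ψ*(κ*x) + Σ_j x_j v_j`.
* `translate_invariant_frame` — `g_K` is invariant under translation by every `K`-combination of the `v_j` (rigidity of FILE 1 + span).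
* **`kill_frame_eq`** — `κ (Ψ g) = Ψ g`: the re-coordinatised polynomial does not see the free variables.
* **`isHomogeneous_frame`** — `Ψ g` is a form of degree `d`.
* `bind₁_unframe_frame` — `Φ (Ψ g) = g`.
* §0' frame-form algebra for the words: `totalDegree_frameForm_le`, `frameForm_sub_C_coeff_zero`, `coeff_single_X`, `linearIndependent_frameLin`.
[folklore]
-/

noncomputable section

-- `Summit.<S>.<S>.…` duplicates the summit name by design (single-problem summit).
set_option linter.dupNamespace false

open MvPolynomial

namespace Summit.ResolutionOfSingularities.ResolutionOfSingularities.Theorems.SwitchingDichotomy.NonRationalWindow.BiConeFrame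

open Summit.ResolutionOfSingularities.ResolutionOfSingularities.Theorems.SwitchingDichotomy.NonRationalWindow.BiConeForms

variable {k K : Type*} [Field k] [Field K] [Algebra k K] {n : ℕ} (J : Finset (Fin n)) (a : Fin n → Fin n → k) (e : Fin n → k)

/-! ## §1 Evaluating the frame substitutions -/

/-- Evaluation of the re-coordinatisation `Ψ` over `K`: `(Ψ φ)(x) = φ(Ψ* x)` with `(Ψ* x)_i = x_i + e_i + Σ_{j∈J} a_ij x_j` off `J`. [folklore] -/
theorem eval_bind₁_frame (x : Fin n → K) (φ : MvPolynomial (Fin n) K) :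
    eval x (bind₁ (fun i => if i ∈ J then X i else X i + C (algebraMap k K (e i)) + ∑ j ∈ J, C (algebraMap k K (a i j)) * X j) φ) =
      eval (fun i => if i ∈ J then x i else x i + algebraMap k K (e i) + ∑ j ∈ J, algebraMap k K (a i j) * x j) φ := by
  rw [show eval x (bind₁ _ φ) = eval₂Hom (RingHom.id K) x (bind₁ _ φ) from rfl, eval₂Hom_bind₁]
  have h : (fun i => eval₂Hom (RingHom.id K) x (if i ∈ J then X i else X i + C (algebraMap k K (e i)) + ∑ j ∈ J, C (algebraMap k K (a i j)) * X j)) =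
      (fun i => if i ∈ J then x i else x i + algebraMap k K (e i) + ∑ j ∈ J, algebraMap k K (a i j) * x j) := by
    funext i
    split_ifs
    · simp
    · simp
  rw [h]
  rfl

/-- Evaluation of the LINEAR part of `Ψ`. [folklore] -/
theorem eval_bind₁_frameLin (x : Fin n → K) (φ : MvPolynomial (Fin n) K) :
    eval x (bind₁ (fun i => if i ∈ J then X i else X i + ∑ j ∈ J, C (algebraMap k K (a i j)) * X j) φ) =
      eval (fun i => if i ∈ J then x i else x i + ∑ j ∈ J, algebraMap k K (a i j) * x j) φ := by
  rw [show eval x (bind₁ _ φ) = eval₂Hom (RingHom.id K) x (bind₁ _ φ) from rfl, eval₂Hom_bind₁]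
  have h : (fun i => eval₂Hom (RingHom.id K) x (if i ∈ J then X i else X i + ∑ j ∈ J, C (algebraMap k K (a i j)) * X j)) =
      (fun i => if i ∈ J then x i else x i + ∑ j ∈ J, algebraMap k K (a i j) * x j) := by
    funext i
    split_ifs
    · simp
    · simp
  rw [h]
  rfl

/-- Evaluation of the projection `κ` killing the free variables. [folklore] -/
theorem eval_bind₁_kill (x : Fin n → K) (φ : MvPolynomial (Fin n) K) :
    eval x (bind₁ (fun i => if i ∈ J then (0 : MvPolynomial (Fin n) K) else X i) φ) = eval (fun i => if i ∈ J then 0 else x i) φ := by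
  rw [show eval x (bind₁ _ φ) = eval₂Hom (RingHom.id K) x (bind₁ _ φ) from rfl, eval₂Hom_bind₁]
  have h : (fun i => eval₂Hom (RingHom.id K) x (if i ∈ J then (0 : MvPolynomial (Fin n) K) else X i)) = (fun i => if i ∈ J then 0 else x i) := by
    funext i
    split_ifs <;> simp
  rw [h]
  rfl

/-- **The frame shift**: `Ψ*(x) = Ψ*(κ* x) + Σ_{j∈J} x_j · v_j` with the frame directions `(v_j)_i = [i = j]` on `J`, `a_ij` off `J`. [folklore] -/
theorem frame_shift (x : Fin n → K) :
    (fun i => if i ∈ J then x i else x i + algebraMap k K (e i) + ∑ j ∈ J, algebraMap k K (a i j) * x j) =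
      (fun i => if i ∈ J then (if i ∈ J then (0 : K) else x i) else (if i ∈ J then (0 : K) else x i) + algebraMap k K (e i) +
          ∑ j ∈ J, algebraMap k K (a i j) * (if j ∈ J then (0 : K) else x j)) +
        ∑ j ∈ J, x j • (fun i => if i ∈ J then (if i = j then (1 : K) else 0) else algebraMap k K (a i j)) := by
  funext i
  simp only [Pi.add_apply, Finset.sum_apply, Pi.smul_apply, smul_eq_mul]
  by_cases hi : i ∈ J
  · simp only [hi, if_true, mul_ite, mul_one, mul_zero]
    rw [Finset.sum_ite_eq J i, if_pos hi, zero_add]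
  · simp only [hi, if_false]
    have h0 : ∑ j ∈ J, algebraMap k K (a i j) * (if j ∈ J then (0 : K) else x j) = 0 :=
      Finset.sum_eq_zero fun j hj => by rw [if_pos hj, mul_zero]
    rw [h0, add_zero]
    simp only [mul_comm (x _)]

/-! ## §2 Invariance along the frame directions -/

variable [Infinite K] {d : ℕ} {g : MvPolynomial (Fin n) k} {P : Set (Fin n → K)}

/-- **`g_K` is invariant under translation by every `K`-combination of the frame directions** — they lie in the span of the differences of vertices,
along which FILE 1's rigidity applies. [folklore] -/
theorem translate_invariant_frame
    (hvert : ∀ p ∈ P, (bind₁ (fun i => X i + C (p i)) (map (algebraMap k K) g)).IsHomogeneous d)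
    (hspan : ∀ j ∈ J, (fun i => if i ∈ J then (if i = j then (1 : K) else 0) else algebraMap k K (a i j)) ∈
      Submodule.span K {w : Fin n → K | ∃ p ∈ P, ∃ p' ∈ P, w = p' - p})
    (c : Fin n → K) (z : Fin n → K) :
    eval (z + ∑ j ∈ J, c j • (fun i => if i ∈ J then (if i = j then (1 : K) else 0) else algebraMap k K (a i j))) (map (algebraMap k K) g) =
      eval z (map (algebraMap k K) g) := by
  -- invariance along every difference of vertices (rigidity), hence along their span
  have hS : ∀ w ∈ {w : Fin n → K | ∃ p ∈ P, ∃ p' ∈ P, w = p' - p}, ∀ (t : K) (y : Fin n → K),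
      eval (y + t • w) (map (algebraMap k K) g) = eval y (map (algebraMap k K) g) := by
    rintro w ⟨p, hp, p', hp', rfl⟩ t y
    exact translate_invariant_of_two_vertices (f := fun y => eval y (map (algebraMap k K) g))
      (vertex_of_translate (hvert p hp)) (vertex_of_translate (hvert p' hp')) t y
  have hsum : (∑ j ∈ J, c j • (fun i => if i ∈ J then (if i = j then (1 : K) else 0) else algebraMap k K (a i j))) ∈
      Submodule.span K {w : Fin n → K | ∃ p ∈ P, ∃ p' ∈ P, w = p' - p} :=
    Submodule.sum_mem _ fun j hj => Submodule.smul_mem _ _ (hspan j hj)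
  have h := translate_invariant_of_mem_span (f := fun y => eval y (map (algebraMap k K) g)) hS hsum 1 z
  simpa using h

/-- **`κ (Ψ g) = Ψ g`** — the re-coordinatised polynomial does not involve the free variables `X_j`, `j ∈ J`. [folklore] -/
theorem kill_frame_eq
    (hvert : ∀ p ∈ P, (bind₁ (fun i => X i + C (p i)) (map (algebraMap k K) g)).IsHomogeneous d)
    (hspan : ∀ j ∈ J, (fun i => if i ∈ J then (if i = j then (1 : K) else 0) else algebraMap k K (a i j)) ∈
      Submodule.span K {w : Fin n → K | ∃ p ∈ P, ∃ p' ∈ P, w = p' - p}) :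
    bind₁ (fun i => if i ∈ J then (0 : MvPolynomial (Fin n) k) else X i)
        (bind₁ (fun i => if i ∈ J then X i else X i + C (e i) + ∑ j ∈ J, C (a i j) * X j) g) =
      bind₁ (fun i => if i ∈ J then X i else X i + C (e i) + ∑ j ∈ J, C (a i j) * X j) g := by
  apply map_injective (algebraMap k K) (algebraMap k K).injective
  rw [map_bind₁, map_bind₁]
  have h1 : (fun i : Fin n => map (algebraMap k K) (if i ∈ J then (0 : MvPolynomial (Fin n) k) else X i)) =
      fun i => if i ∈ J then (0 : MvPolynomial (Fin n) K) else X i := by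
    funext i; split_ifs <;> simp
  have h2 : (fun i : Fin n => map (algebraMap k K) (if i ∈ J then X i else X i + C (e i) + ∑ j ∈ J, C (a i j) * X j)) =
      fun i => if i ∈ J then X i else X i + C (algebraMap k K (e i)) + ∑ j ∈ J, C (algebraMap k K (a i j)) * X j := by
    funext i; split_ifs <;> simp [map_sum]
  rw [h1, h2]
  apply MvPolynomial.funext
  intro x
  rw [eval_bind₁_kill, eval_bind₁_frame, eval_bind₁_frame]
  have key := translate_invariant_frame J a (g := g) hvert hspan x
    (fun i => if i ∈ J then (if i ∈ J then (0 : K) else x i) else (if i ∈ J then (0 : K) else x i) + algebraMap k K (e i) +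
      ∑ j ∈ J, algebraMap k K (a i j) * (if j ∈ J then (0 : K) else x j))
  rw [← frame_shift J a e x] at key
  exact key.symm

/-- **`Ψ g` is a form of degree `d`**: translate the free variables by the free part of a vertex `p` (invariance), and compare with the LINEAR part
of `Ψ` applied to the form `g_K(X + p)`. [folklore] -/
theorem isHomogeneous_frame {p : Fin n → K} (hp : p ∈ P)
    (hvert : ∀ p ∈ P, (bind₁ (fun i => X i + C (p i)) (map (algebraMap k K) g)).IsHomogeneous d)
    (hvan : ∀ p ∈ P, ∀ i ∉ J, p i = algebraMap k K (e i) + ∑ j ∈ J, algebraMap k K (a i j) * p j)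
    (hspan : ∀ j ∈ J, (fun i => if i ∈ J then (if i = j then (1 : K) else 0) else algebraMap k K (a i j)) ∈
      Submodule.span K {w : Fin n → K | ∃ p ∈ P, ∃ p' ∈ P, w = p' - p}) :
    (bind₁ (fun i => if i ∈ J then X i else X i + C (e i) + ∑ j ∈ J, C (a i j) * X j) g).IsHomogeneous d := by
  apply IsHomogeneous.of_map (algebraMap k K).injective
  rw [map_bind₁]
  have h2 : (fun i : Fin n => map (algebraMap k K) (if i ∈ J then X i else X i + C (e i) + ∑ j ∈ J, C (a i j) * X j)) =
      fun i => if i ∈ J then X i else X i + C (algebraMap k K (e i)) + ∑ j ∈ J, C (algebraMap k K (a i j)) * X j := by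
    funext i; split_ifs <;> simp [map_sum]
  rw [h2]
  -- the linear part of `Ψ` applied to the form `g_K(X + p)` is a form of degree `d`
  have hform : (bind₁ (fun i => if i ∈ J then X i else X i + ∑ j ∈ J, C (algebraMap k K (a i j)) * X j)
      (bind₁ (fun i => X i + C (p i)) (map (algebraMap k K) g))).IsHomogeneous d := by
    have h := (hvert p hp).aeval (fun i => if i ∈ J then X i else X i + ∑ j ∈ J, C (algebraMap k K (a i j)) * X j) (n := 1)
      (fun i => by
        split_ifs
        · exact isHomogeneous_X K i
        · exact (isHomogeneous_X K i).add (IsHomogeneous.sum _ _ _ fun j _ => isHomogeneous_C_mul_X _ _))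
    rw [one_mul, aeval_eq_bind₁] at h
    exact h
  -- and it EQUALS `Ψ_K g_K` (pointwise: the free part of `p` is a translation direction, the bound part is read off `hvan`)
  have heq : bind₁ (fun i => if i ∈ J then X i else X i + ∑ j ∈ J, C (algebraMap k K (a i j)) * X j)
      (bind₁ (fun i => X i + C (p i)) (map (algebraMap k K) g)) =
      bind₁ (fun i => if i ∈ J then X i else X i + C (algebraMap k K (e i)) + ∑ j ∈ J, C (algebraMap k K (a i j)) * X j)
        (map (algebraMap k K) g) := by
    apply MvPolynomial.funext
    intro x
    rw [eval_bind₁_frameLin, eval_bind₁_translate, eval_bind₁_frame]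
    -- `Ψlin*(x) + p = Ψ*(x) + Σ_j p_j v_j − (terms killed)`: precisely `Ψlin*(x) + p = Ψ*(x) + Σ_{j∈J} p_j • v_j`
    have hvec : ((fun i => if i ∈ J then x i else x i + ∑ j ∈ J, algebraMap k K (a i j) * x j) + p) =
        (fun i => if i ∈ J then x i else x i + algebraMap k K (e i) + ∑ j ∈ J, algebraMap k K (a i j) * x j) +
          ∑ j ∈ J, p j • (fun i => if i ∈ J then (if i = j then (1 : K) else 0) else algebraMap k K (a i j)) := by
      funext i
      simp only [Pi.add_apply, Finset.sum_apply, Pi.smul_apply, smul_eq_mul]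
      by_cases hi : i ∈ J
      · simp only [hi, if_true, mul_ite, mul_one, mul_zero]
        rw [Finset.sum_ite_eq J i, if_pos hi]
      · simp only [hi, if_false]
        rw [hvan p hp i hi]
        have hc : ∑ j ∈ J, p j * algebraMap k K (a i j) = ∑ j ∈ J, algebraMap k K (a i j) * p j :=
          Finset.sum_congr rfl fun j _ => mul_comm _ _
        rw [hc]
        ring
    rw [hvec]
    exact translate_invariant_frame J a hvert hspan _ _
  rw [← heq]
  exact hform

/-- **`Φ (Ψ g) = g`**: `Φ : X_i ↦ λ_i := X_i − C e_i − Σ_{j∈J} C a_ij X_j` (`i ∉ J`) inverts the re-coordinatisation. [folklore] -/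
theorem bind₁_unframe_frame (φ : MvPolynomial (Fin n) k) :
    bind₁ (fun i => if i ∈ J then X i else X i - C (e i) - ∑ j ∈ J, C (a i j) * X j)
        (bind₁ (fun i => if i ∈ J then X i else X i + C (e i) + ∑ j ∈ J, C (a i j) * X j) φ) = φ := by
  rw [bind₁_bind₁]
  have h : (fun i => bind₁ (fun i => if i ∈ J then X i else X i - C (e i) - ∑ j ∈ J, C (a i j) * X j)
      (if i ∈ J then X i else X i + C (e i) + ∑ j ∈ J, C (a i j) * X j)) = (X : Fin n → MvPolynomial (Fin n) k) := by
    funext i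
    by_cases hi : i ∈ J
    · simp [hi]
    · simp only [hi, if_false, map_add, map_sum, map_mul, bind₁_C_right, bind₁_X_right]
      have hs : ∑ j ∈ J, C (a i j) * (if j ∈ J then X j else X j - C (e j) - ∑ j' ∈ J, C (a j j') * X j') =
          ∑ j ∈ J, C (a i j) * X j := Finset.sum_congr rfl fun j hj => by rw [if_pos hj]
      rw [hs]
      ring
  rw [h, bind₁_X_left]
  rfl

/-! ## §0 Small algebra of the frame forms -/

section FrameForms

variable {k₀ : Type} [Field k₀] {n₀ : ℕ} (J : Finset (Fin n₀)) (a : Fin n₀ → Fin n₀ → k₀) (c : Fin n₀ → k₀)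

/-- The frame forms are affine-linear. [folklore] -/
theorem totalDegree_frameForm_le (i : Fin n₀) : (X i - C (c i) - ∑ j ∈ J, C (a i j) * X j : MvPolynomial (Fin n₀) k₀).totalDegree ≤ 1 := by
  refine (totalDegree_sub _ _).trans (max_le ((totalDegree_sub _ _).trans (max_le (by rw [totalDegree_X]) (by rw [totalDegree_C]; exact zero_le_one))) ?_)
  refine (totalDegree_finsetSum _ _).trans (Finset.sup_le fun j _ => (totalDegree_mul _ _).trans ?_)
  rw [totalDegree_C, totalDegree_X, zero_add]

/-- The linear part of a frame form. [folklore] -/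
theorem frameForm_sub_C_coeff_zero (i : Fin n₀) :
    (X i - C (c i) - ∑ j ∈ J, C (a i j) * X j : MvPolynomial (Fin n₀) k₀) - C (coeff 0 (X i - C (c i) - ∑ j ∈ J, C (a i j) * X j : MvPolynomial (Fin n₀) k₀)) =
      X i - ∑ j ∈ J, C (a i j) * X j := by
  simp only [coeff_sub, coeff_sum, coeff_C_mul, coeff_zero_X, coeff_zero_C, mul_zero, Finset.sum_const_zero, sub_zero, zero_sub, map_neg]
  ring

/-- The `X_i`-coefficient of a variable. [folklore] -/
theorem coeff_single_X (i j : Fin n₀) : coeff (Finsupp.single i 1) (X j : MvPolynomial (Fin n₀) k₀) = if i = j then 1 else 0 := by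
  classical
  rw [coeff_X]
  by_cases h : i = j
  · subst h; simp
  · rw [if_neg (fun h' => h (Finsupp.single_left_injective one_ne_zero h').symm), if_neg h]

/-- **The linear parts `X_i − Σ_{j∈J} a_ij X_j` of frame forms with distinct bound indices `i ∉ J` are linearly independent** (read the
`X_i`-coefficients: they form the standard basis). [folklore] -/
theorem linearIndependent_frameLin {ι : Type} [Fintype ι] (idx : ι → Fin n₀) (hidx : Function.Injective idx) (hJ : ∀ t, idx t ∉ J) :
    LinearIndependent k₀ (fun t => (X (idx t) - ∑ j ∈ J, C (a (idx t) j) * X j : MvPolynomial (Fin n₀) k₀)) := by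
  classical
  let π : MvPolynomial (Fin n₀) k₀ →ₗ[k₀] (ι → k₀) := LinearMap.pi fun t => lcoeff k₀ (Finsupp.single (idx t) 1)
  refine LinearIndependent.of_comp π ?_
  have h : π ∘ (fun t => (X (idx t) - ∑ j ∈ J, C (a (idx t) j) * X j : MvPolynomial (Fin n₀) k₀)) = fun t => Pi.single t (1 : k₀) := by
    funext t
    funext t'
    simp only [Function.comp_apply, π, LinearMap.pi_apply, lcoeff_apply, coeff_sub, coeff_sum, coeff_C_mul, coeff_single_X, Pi.single_apply]
    have h0 : ∑ j ∈ J, a (idx t) j * (if idx t' = j then (1 : k₀) else 0) = 0 :=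
      Finset.sum_eq_zero fun j hj => by
        rw [if_neg, mul_zero]
        rintro rfl
        exact hJ t' hj
    rw [h0, sub_zero]
    by_cases htt : t' = t
    · subst htt; simp
    · rw [if_neg (fun h => htt (hidx h)), if_neg htt]
  rw [h]
  exact Pi.linearIndependent_single_one ι k₀

end FrameForms


end Summit.ResolutionOfSingularities.ResolutionOfSingularities.Theorems.SwitchingDichotomy.NonRationalWindow.BiConeFrame

end
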